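import Summits.ValiantsHypothesis.ValiantsHypothesis.Theorems.LacunarySymmetroidMatrixDescartesCensusTropicalKLawStatic

/-!
# Route «KPlusLogSqLaw», crux `TropicalB` — per-entry class monotonicity along dominant chains (a non-counting structural lemma)

HONEST FRAMING.  Helper toward the tropical crux `Summit.ValiantsHypothesis.ValiantsHypothesis.Theses.KPlusLogSqLaw.TropicalB`
(item `stmt-ValiantsHypothesis-19771`) and the `K = 4` fork of `Lifting` (item `…-19772`), object-search cell `pub-symmetroid`,
seat val-sym-lift-p3, 2026-08-26.  Two sorry-free facts about the tree's dominance vocabulary (`tropWeight`, `termSign`,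
`IsDominant` of `MatrixDescartesFalseOfTropicalMonster.lean`), valid for EVERY design of every format `(m, K)`:

* `d_lt_of_isDominant_of_sameEntry` — **per-entry class monotonicity ACROSS permutations**: if the unique optimum at slope `θ₁`
  and the unique optimum at a larger slope `θ₂` use the same entry `(σ b, b)` with different classes `l₁ ≠ l₂`, then
  `d l₁ < d l₂`.  (Exchange argument: re-classing that one entry in either optimum gives a present competitor; adding the two
  strict dominance inequalities leaves `(θ₁ − θ₂)(d l₁ − d l₂) > 0`.)  The tree's `tropRootLawAt_thin` uses the same-permutation
  shadow of this («for fixed `σ` the dominant class vectors form a chain»); the point here is that the permutation may differ.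
* `card_permSteps_le` — consequently, along ANY chain of unique optima at strictly increasing slopes with pairwise distinct
  consecutive terms (e.g. a sign-alternating chain as in `TropRootLawAt`, cf. `KPlusLogSqLaw.ne_succ_of_alternating`), the number of
  steps that KEEP the permutation is at
  most `m·m·K` in total (each such step strictly upgrades one entry between two consecutive uses, and an entry is never
  downgraded).  So `T(m,K) ≤ m²K + #{permutation-changing steps}`: the class digit of the cell's SHIFT-THREE family (which has
  only `m` permutations and `≈ m²/2` class steps) cannot be re-used per phase, and a CUBIC tropical family at `K = 4` — the open
  fork behind `stub_liftThin` — would need `Ω(m³)` DISTINCT dominant permutations, i.e. it is a question about breakpoints of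
  4-slope-class parametric ASSIGNMENT problems (cf. `Literature/…/BirkhoffShadow.lean`).  Cell memo with the LP test that found
  this: `HOME/val-sym-lift-p3/K4-NESTED-ROTATION-OBSTRUCTION.md`.
Nothing here asserts `TropicalB`, `Lifting`, `KPlusLogSqLaw`, `MatrixDescartes` or anything about `VP ≠ VNP`.
-/

set_option linter.dupNamespace false
set_option autoImplicit false

namespace Summit.ValiantsHypothesis.ValiantsHypothesis.Theorems.LacunarySymmetroidMatrixDescartes.TropicalCensus

open Summit.ValiantsHypothesis.ValiantsHypothesis.Theorems.MatrixDescartes.Negative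
open scoped BigOperators
open Finset

section ClassMonotone

variable {m K : ℕ}

/-- re-classing one column changes the tropical weight by the local difference. -/
theorem tropWeight_update (d : Fin K → ℕ) (v : Fin m → Fin m → Fin K → ℤ) (θ : ℤ) (σ : Equiv.Perm (Fin m))
    (la : Fin m → Fin K) (b : Fin m) (c : Fin K) :
    tropWeight d v θ (σ, Function.update la b c) =
      tropWeight d v θ (σ, la) + (θ * (d c : ℤ) - v (σ b) b c) - (θ * (d (la b) : ℤ) - v (σ b) b (la b)) := by
  unfold tropWeight
  simp only
  rw [sum_update_arg (fun _ l => (d l : ℤ)) la b c, sum_update_arg (fun j l => v (σ j) j l) la b c]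
  ring

/-- a present term stays present after re-classing one column to a present entry-class (entry-level form of
`termSign_update_ne_zero`, which asks for a second present term with the same permutation). -/
theorem termSign_update_entry_ne_zero (ε : Fin m → Fin m → Fin K → ℤ) (σ : Equiv.Perm (Fin m)) (la : Fin m → Fin K)
    (b : Fin m) (c : Fin K) (h : termSign ε (σ, la) ≠ 0) (hc : ε (σ b) b c ≠ 0) :
    termSign ε (σ, Function.update la b c) ≠ 0 := by
  unfold termSign at h ⊢
  simp only at h ⊢
  refine mul_ne_zero (Units.ne_zero _) ?_
  have h' := Finset.prod_ne_zero_iff.mp (right_ne_zero_of_mul h)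
  rw [Finset.prod_ne_zero_iff]
  intro i _
  by_cases hib : i = b
  · subst hib; rwa [Function.update_self]
  · rw [Function.update_of_ne hib]; exact h' i (Finset.mem_univ i)

/-- **Per-entry class monotonicity across permutations.**  If the unique optima at slopes `θ₁ < θ₂` use the same entry in
column `b` (`σ₁ b = σ₂ b`) with different classes, the later class has the larger exponent. -/
theorem d_lt_of_isDominant_of_sameEntry (d : Fin K → ℕ) (v ε : Fin m → Fin m → Fin K → ℤ) {θ₁ θ₂ : ℤ} (hθ : θ₁ < θ₂)
    {q₁ q₂ : Equiv.Perm (Fin m) × (Fin m → Fin K)} (h₁ : IsDominant d v ε θ₁ q₁) (h₂ : IsDominant d v ε θ₂ q₂)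
    (b : Fin m) (hb : q₁.1 b = q₂.1 b) (hne : q₁.2 b ≠ q₂.2 b) : d (q₁.2 b) < d (q₂.2 b) := by
  obtain ⟨σ₁, l₁⟩ := q₁
  obtain ⟨σ₂, l₂⟩ := q₂
  dsimp only at hb hne ⊢
  have he₁ : ε (σ₁ b) b (l₁ b) ≠ 0 := present_of_termSign_ne_zero ε (σ₁, l₁) h₁.1 b
  have he₂ : ε (σ₂ b) b (l₂ b) ≠ 0 := present_of_termSign_ne_zero ε (σ₂, l₂) h₂.1 b
  -- the two exchanged competitors
  have hPne : (σ₁, Function.update l₁ b (l₂ b)) ≠ (σ₁, l₁) := by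
    intro h
    have h' : Function.update l₁ b (l₂ b) = l₁ := congrArg Prod.snd h
    rw [Function.update_eq_self_iff] at h'
    exact hne h'.symm
  have hSne : (σ₂, Function.update l₂ b (l₁ b)) ≠ (σ₂, l₂) := by
    intro h
    have h' : Function.update l₂ b (l₁ b) = l₂ := congrArg Prod.snd h
    rw [Function.update_eq_self_iff] at h'
    exact hne h'
  have hPpres : termSign ε (σ₁, Function.update l₁ b (l₂ b)) ≠ 0 :=
    termSign_update_entry_ne_zero ε σ₁ l₁ b (l₂ b) h₁.1 (by rw [hb]; exact he₂)
  have hSpres : termSign ε (σ₂, Function.update l₂ b (l₁ b)) ≠ 0 :=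
    termSign_update_entry_ne_zero ε σ₂ l₂ b (l₁ b) h₂.1 (by rw [← hb]; exact he₁)
  have hA := h₁.2 _ hPne hPpres
  have hB := h₂.2 _ hSne hSpres
  rw [tropWeight_update] at hA hB
  rw [← hb] at hB
  -- add the two strict inequalities
  by_contra hcon
  have hcon' : (d (l₂ b) : ℤ) ≤ d (l₁ b) := by exact_mod_cast Nat.le_of_not_lt hcon
  nlinarith [mul_nonneg (sub_nonneg.mpr hθ.le) (sub_nonneg.mpr hcon')]

/-- one-directional form of the injectivity behind `card_permSteps_le`. -/
theorem permStep_noRepeat (d : Fin K → ℕ) (v ε : Fin m → Fin m → Fin K → ℤ) {n : ℕ} (θ : Fin (n + 1) → ℤ)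
    (hθ : StrictMono θ) (p : Fin (n + 1) → Equiv.Perm (Fin m) × (Fin m → Fin K))
    (hdom : ∀ k, IsDominant d v ε (θ k) (p k)) (k k' : Fin n) (hkk' : k < k')
    (hk : (p k.castSucc).1 = (p k.succ).1) (b : Fin m) (hb : (p k.castSucc).2 b ≠ (p k.succ).2 b)
    (hrow : (p k.castSucc).1 b = (p k'.castSucc).1 b) (hcls : (p k.castSucc).2 b = (p k'.castSucc).2 b) : False := by
  -- the step k upgrades the entry strictly
  have hup : d ((p k.castSucc).2 b) < d ((p k.succ).2 b) :=
    d_lt_of_isDominant_of_sameEntry d v ε (hθ (show k.castSucc < k.succ from Fin.castSucc_lt_succ)) (hdom _) (hdom _) b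
      (by rw [hk]) hb
  -- positions: k.succ ≤ k'.castSucc
  have hle : (k.succ : Fin (n + 1)) ≤ k'.castSucc := by
    rw [Fin.le_iff_val_le_val, Fin.val_succ, Fin.val_castSucc]; exact hkk'
  rcases hle.eq_or_lt with heq | hlt
  · -- same term: its class in column `b` is both the upgraded one and the old one
    have h1 : (p k.succ).2 b = (p k'.castSucc).2 b := by rw [heq]
    rw [← hcls] at h1
    exact hb h1.symm
  · -- a later optimum re-uses the entry with the old (smaller) class: contradiction with monotonicity
    have hrow' : (p k.succ).1 b = (p k'.castSucc).1 b := by rw [← hk]; exact hrow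
    have hne' : (p k.succ).2 b ≠ (p k'.castSucc).2 b := by
      rw [← hcls]; exact fun h => hb h.symm
    have hdown := d_lt_of_isDominant_of_sameEntry d v ε (hθ hlt) (hdom _) (hdom _) b hrow' hne'
    rw [← hcls] at hdown
    exact lt_asymm hup hdown

/-- **The permutation-keeping steps of a dominant chain are at most `m·m·K`.**  For unique optima `p 0, …, p n` at strictly
increasing integer slopes with `p k ≠ p (k+1)`, the number of `k < n` with the same permutation at `k` and `k+1` is at most
`m·m·K`: the map `k ↦ (entry, old class)` of a re-classed column is injective by `d_lt_of_isDominant_of_sameEntry`. -/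
theorem card_permSteps_le (d : Fin K → ℕ) (v ε : Fin m → Fin m → Fin K → ℤ) {n : ℕ} (θ : Fin (n + 1) → ℤ)
    (hθ : StrictMono θ) (p : Fin (n + 1) → Equiv.Perm (Fin m) × (Fin m → Fin K))
    (hdom : ∀ k, IsDominant d v ε (θ k) (p k)) (hne : ∀ k : Fin n, p k.castSucc ≠ p k.succ) :
    ((Finset.univ : Finset (Fin n)).filter (fun k => (p k.castSucc).1 = (p k.succ).1)).card ≤ m * m * K := by
  classical
  set S := (Finset.univ : Finset (Fin n)).filter (fun k => (p k.castSucc).1 = (p k.succ).1) with hS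
  have hcol : ∀ k ∈ S, ∃ b, (p k.castSucc).2 b ≠ (p k.succ).2 b := by
    intro k hk
    have hσ := (Finset.mem_filter.mp hk).2
    by_contra h
    push Not at h
    exact hne k (Prod.ext hσ (funext h))
  rcases Nat.eq_zero_or_pos m with hm | hm
  · -- no columns: no permutation-keeping step exists
    subst hm
    have hS0 : S = ∅ := by
      apply Finset.eq_empty_of_forall_notMem
      intro k hk
      obtain ⟨b, _⟩ := hcol k hk
      exact b.elim0
    rw [hS0, Finset.card_empty]
    exact Nat.zero_le _
  haveI : Nonempty (Fin m) := ⟨⟨0, hm⟩⟩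
  choose! col hcol using hcol
  let f : Fin n → (Fin m × Fin m) × Fin K := fun k => (((p k.castSucc).1 (col k), col k), (p k.castSucc).2 (col k))
  have hinj : Set.InjOn f S := by
    intro k hk k' hk' hff
    have hkS := (Finset.mem_filter.mp hk).2
    have hk'S := (Finset.mem_filter.mp hk').2
    have h2 : col k = col k' := congrArg (fun x => x.1.2) hff
    have h1 : (p k.castSucc).1 (col k) = (p k'.castSucc).1 (col k') := congrArg (fun x => x.1.1) hff
    have h3 : (p k.castSucc).2 (col k) = (p k'.castSucc).2 (col k') := congrArg (fun x => x.2) hff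
    rcases lt_trichotomy k k' with hlt | heq | hgt
    · exfalso
      refine permStep_noRepeat d v ε θ hθ p hdom k k' hlt hkS (col k) (hcol k hk) ?_ ?_
      · rw [h1, ← h2]
      · rw [h3, ← h2]
    · exact heq
    · exfalso
      refine permStep_noRepeat d v ε θ hθ p hdom k' k hgt hk'S (col k') (hcol k' hk') ?_ ?_
      · rw [← h1, h2]
      · rw [← h3, h2]
  calc S.card = (S.image f).card := (Finset.card_image_of_injOn hinj).symm
    _ ≤ (Finset.univ : Finset ((Fin m × Fin m) × Fin K)).card := Finset.card_le_card (Finset.subset_univ _)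
    _ = m * m * K := by simp [Fintype.card_prod, Fintype.card_fin]

end ClassMonotone

end Summit.ValiantsHypothesis.ValiantsHypothesis.Theorems.LacunarySymmetroidMatrixDescartes.TropicalCensus
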